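import Summits.ResolutionOfSingularities.ResolutionOfSingularities.Theorems.HilbertSamuelEliminationSigmaMaxModificationsCorridor3SigmaIsoBoundaryReaches
import Summits.ResolutionOfSingularities.ResolutionOfSingularities.Theorems.HilbertSamuelEliminationSigmaMaxModificationsCorridor3SigmaIsoBoundaryRows
import Summits.ResolutionOfSingularities.ResolutionOfSingularities.Theorems.HilbertSamuelEliminationSigmaMaxModificationsCorridor3SigmaIsoExtraction
import HarnessLib

/-!
# [OURS · L1 W4.2] σ-LAYER — `Corridor3SigmaIsoBoundaryExtraction`: THE ISOLATED KERNEL IS STRATEGY-FREE, BOUNDARY-THREADED —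
# `IsoTailTowerExtractionMσE σ p E₀` HOLDS for every ADMISSIBLE FUNCTIONAL boundary-reading strategy `σ : StrategyE`; hence the pointed σE-closer from
# admissibility + KERNEL + σ-laws — part 2/2 (res-L1-w42-plan-1 RULING v3.14-12a (BR-10); W4.2 DEAL D16-σ, RULINGS v3.14-11a (CP); crux chain w42
# `SigmaMaxModificationsCorridor3` stmt-ResolutionOfSingularities-19249 / crux stmt-…-18506; `--supports stmt-ResolutionOfSingularities-19249 --as helper`, counted 0)

HONEST FRAMING. OURS proof file (theorem-only, no new definition, fact-free); NOTHING here is a statement of H. Hironaka's manuscript [Hironaka2017] nor of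
Cossart–Jannsen–Saito. Every `theorem` is the E-COPY (chains of o1's `MarkedStageE`, admissibility `IsAdmissibleStrategyOnE (StrategyE.ReachableState p σ 3 ν E₀)`,
functionality `StrategyE.IsFunctional`) of the BLIND theorem of the same name without `E` in `…Corridor3SigmaIsoExtraction` (p526163), SAME proof over part 1/2
`…Corridor3SigmaIsoBoundaryReaches`; everything strategy-independent (`Moving.exists_stageTower`, `Moving.isIsolatedInHSMaxLocus_of_spec`, `Moving.exists_towerStructure`,
`Moving.tower_dim_le`, `Moving.tower_supMax`, `BlowupTower.isIsolatedInHSMaxLocus_localize`, `isIsolatedInHSMaxLocus_spec_of_iso`, `isPermissible_singleton_of_three_le_geomDirDim`)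
is CITED. So THE POINT of RULINGS (CP) holds for the hybrid `ω_ρ` (a `StrategyE`) as for any blind strategy: at an isolated point the quadratic tower is
σ-independent, boundary or not. AI-written; AI review is weaker than expert review.

## Contents (namespace `…Theorems.SigmaMaxModificationsCorridor3.Sigma`)

* §5 `exists_isoStageTower_of_movingChainσE`. §6 **`isoTailTowerExtractionσE_of_admissible`** (ν-sliced) and the row **`isoTailTowerExtractionMσE_of_admissible
  (hfun : ∀ ν, σ.IsFunctional 3 ν) (hadm : ∀ ν, IsAdmissibleStrategyOnE (StrategyE.ReachableState p σ 3 ν E₀) 3 ν σ) : IsoTailTowerExtractionMσE σ p E₀`**.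
* §7 COROLLARIES through `…Corridor3SigmaIsoBoundaryRows`: `wtopEvIsoMσE_of_admissible`, **`wtopRecIsoMσE_pointed_of_admissible`**, `wtopRecIsoMσE_of_admissible` (every `Q`),
  `atQσE_of_admissible_evNonIso` (the FULL W-top σE-row at `Q` from admissibility + KERNEL + σ-laws + o1's `WtopEvNonIsoMσE σ p Q E₀`). (No run-wise-scope variants
  yet: the E-threaded run scope lands with res-D-pv-047's (E5) `…SigmaBoundaryCompactness`.)

## References (context only)

* V. Cossart, U. Jannsen, S. Saito, LNM 2270 (2020): p. 107, Thm. 3.10 (1), Lemma 2.36, Def. 6.34, Def. 6.38, Def. 13.3, Rem. 6.29 (1). [CossartJannsenSaito2020]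
* U. Görtz, T. Wedhorn, *Algebraic Geometry I* (2nd ed. 2020), Prop. 13.91. [GortzWedhorn2020]
-/

noncomputable section

set_option linter.dupNamespace false -- mandated namespace of this single-conjunct summit

open CategoryTheory CategoryTheory.Limits AlgebraicGeometry TopologicalSpace IsLocalRing
open Literature.AlgebraicGeometry.Resolution Literature.RingTheory.HilbertSamuel
open Scheme.IdealSheafData
open Literature.AlgebraicGeometry.CossartJannsenSaito2020
open Summit.ResolutionOfSingularities.ResolutionOfSingularities.Theorems.CampaignW42
open Summit.ResolutionOfSingularities.ResolutionOfSingularities.Theorems.SigmaMaxModificationsCorridor3.Moving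
open Summit.ResolutionOfSingularities.ResolutionOfSingularities.Theorems.SigmaMaxModificationsCorridor3.Helpers (QPointed)
open Summit.ResolutionOfSingularities.ResolutionOfSingularities.Cruxes.SigmaMaxModifications.IdeasL1Idea2R4

namespace Summit.ResolutionOfSingularities.ResolutionOfSingularities.Theorems.SigmaMaxModificationsCorridor3.Sigma

universe u

variable {p : ℕ} {σ : StrategyE.{u}} {N : ℕ} {ν : ℕ → ℕ} {E₀ : ∀ (X : Scheme.{u}), X → Boundary X}

/-! ## §5. The stage tower of a moving σ-chain with isolated blown-up points -/

/-- **FROM A MOVING σ-CHAIN WITH ISOLATED BLOWN-UP POINTS TO ITS STAGE TOWER** (σ functional, admissible on the marked scope; σ-port of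
res-D-pv-042's `Moving.exists_isoStageTower_of_movingChain`, same proof): let `c` be a chain of σ-near steps from a maximal origin `(X, x)`,
blown up (σ-sense) infinitely often, whose blown-up marked points are ISOLATED in the Hilbert–Samuel locus. Then there are the GENUINE
STAGES `n_0 < n_1 < ⋯` (all blown-up stages from `n_0` on) and a tower `T` of blow-ups of closed points with `T.X 0 = X_{n_0}`,
`y_0 = x_{n_0}` (every property of `(X_{n_0}, x_{n_0})` transfers), closed marked points `y_{j+1} ↦ y_j`, `T.C j = {y_j}`, and
`𝒪_{T.X j,y_j} ≅ 𝒪_{X_{n_j},x_{n_j}}` — the strategy-free recursion `Moving.exists_stageTower` fed the genuine σ-steps of §4 and the waiting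
links of §3. [cite: CossartJannsenSaito2020, p. 107, Def. 6.34, Def. 6.38, Rem. 6.29 (1)] -/
theorem exists_isoStageTower_of_movingChainσE (hfun : σ.IsFunctional N ν)
    (hadm : IsAdmissibleStrategyOnE (StrategyE.ReachableState p σ N ν E₀) N ν σ) {X : Scheme.{u}} [IsLocallyNoetherian X] {x : X}
    (hX : IsMaximalOrigin p N ν X x) {c : ℕ → MarkedStageE.{u}} (h0 : ReachesσE σ N ν (MarkedStageE.init X x (E₀ X x)) (c 0))
    (hstep : ∀ n, CanonicalNearStepσE σ N ν (c n) (c (n + 1))) (hmov : ∀ n, ∃ m, n ≤ m ∧ (c m).IsBlownUpσE σ N ν)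
    (hI : ∀ n, (c n).IsBlownUpσE σ N ν → Iso N (c n).toMarkedStage) :
    ∃ (g : ℕ → ℕ) (T : BlowupTower.{u}) (y : ∀ j, T.X j),
      StrictMono g ∧ (∀ j, (c (g j)).IsBlownUpσE σ N ν) ∧ (∀ m, g 0 ≤ m → (c m).IsBlownUpσE σ N ν → ∃ j, g j = m) ∧
      (∀ j, T.C j = {y j}) ∧ (∀ j, IsClosed ({y j} : Set (T.X j))) ∧ (∀ j, (T.π j).base (y (j + 1)) = y j) ∧
      (∀ j, Nonempty ((T.X j).presheaf.stalk (y j) ≅ (c (g j)).W.presheaf.stalk (c (g j)).pt)) ∧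
      (∀ P : ∀ Y : Scheme.{u}, Y → Prop, P (c (g 0)).W (c (g 0)).pt → P (T.X 0) (y 0)) := by
  classical
  -- the genuine stages: `next n` = the first blown-up stage `≥ n`
  let next : ℕ → ℕ := fun n => Nat.find (hmov n)
  have next_spec : ∀ n, n ≤ next n ∧ (c (next n)).IsBlownUpσE σ N ν := fun n => Nat.find_spec (hmov n)
  have next_min : ∀ n m, n ≤ m → (c m).IsBlownUpσE σ N ν → next n ≤ m :=
    fun n m hnm hb => Nat.find_min' (hmov n) ⟨hnm, hb⟩
  have next_wait : ∀ n m, n ≤ m → m < next n → ¬ (c m).IsBlownUpσE σ N ν :=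
    fun n m hnm hlt hb => absurd (next_min n m hnm hb) (not_le.mpr hlt)
  let g : ℕ → ℕ := fun j => Nat.rec (next 0) (fun _ gj => next (gj + 1)) j
  have g_succ : ∀ j, g (j + 1) = next (g j + 1) := fun j => rfl
  have g_blown : ∀ j, (c (g j)).IsBlownUpσE σ N ν := by
    intro j
    cases j with
    | zero => exact (next_spec 0).2
    | succ j => rw [g_succ]; exact (next_spec _).2
  have g_lt : ∀ j, g j < g (j + 1) := fun j => by
    rw [g_succ]; exact Nat.lt_of_lt_of_le (Nat.lt_succ_self _) (next_spec _).1
  have g_mono : StrictMono g := strictMono_nat_of_lt_succ g_lt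
  have g_all : ∀ m, g 0 ≤ m → (c m).IsBlownUpσE σ N ν → ∃ j, g j = m := by
    intro m hm hb
    have hex : ∃ j, m < g (j + 1) := ⟨m, Nat.lt_of_lt_of_le (Nat.lt_succ_self m) (g_mono.id_le (m + 1))⟩
    obtain ⟨j₀, hj₀, hmin⟩ : ∃ j₀, m < g (j₀ + 1) ∧ ∀ k < j₀, ¬ m < g (k + 1) :=
      ⟨Nat.find hex, Nat.find_spec hex, fun k hk => Nat.find_min hex hk⟩
    have hle : g j₀ ≤ m := by
      cases j₀ with
      | zero => exact hm
      | succ k => exact not_lt.mp (hmin k (Nat.lt_succ_self k))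
    refine ⟨j₀, le_antisymm hle (not_lt.mp fun hlt => ?_)⟩
    have h1 : g (j₀ + 1) ≤ m := by rw [g_succ]; exact next_min _ m hlt hb
    exact absurd hj₀ (not_lt.mpr h1)
  -- the genuine step data at each `g j`
  have hreach : ∀ n, ReachesσE σ N ν (MarkedStageE.init X x (E₀ X x)) (c n) := reachesσE_chain h0 hstep
  have hgen := fun j => exists_genuineStep_of_isoσE hfun hadm hX (hreach (g j)) (hstep (g j)) (g_blown j)
    (hI (g j) (g_blown j))
  choose Cc x' hC hmax hπ hcl hiso using hgen
  -- links: `𝒪_{Bℓ,x'_j} ≅ 𝒪_{X_{g j + 1}} ≅ 𝒪_{X_{g (j+1)}}` (waiting segment)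
  have hlink : ∀ j, Nonempty ((blowup (Cc j)).presheaf.stalk (x' j) ≅
      (c (g (j + 1))).W.presheaf.stalk (c (g (j + 1))).pt) := by
    intro j
    obtain ⟨e₁⟩ := hiso j
    obtain ⟨e₂⟩ := nonempty_stalkIso_of_waitingσE hstep (a := g j + 1) (b := g (j + 1))
      (by rw [g_succ]; exact (next_spec _).1) (fun m hm hlt => next_wait (g j + 1) m hm (by rw [← g_succ]; exact hlt))
    exact ⟨e₁ ≪≫ e₂⟩
  -- the stage tower (strategy-free recursion `Moving.exists_stageTower`)
  haveI : ∀ j, IsLocallyNoetherian (c (g j)).W := fun j => (c (g j)).ln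
  have hx0 : IsClosed ({(c (g 0)).pt} : Set (c (g 0)).W) := (hreach (g 0)).isClosed_pt hX.isClosed
  obtain ⟨T, y, hC', hycl, hover, hstalk, htr⟩ :=
    exists_stageTower (W := fun j => (c (g j)).W) (W' := fun j => blowup (Cc j)) (fun j => blowup.π (Cc j)) Cc
      (fun j => blowup.isBlowup (Cc j)) hC (fun j => (c (g j)).pt) hmax x' hπ hcl hlink hx0
  exact ⟨g, T, y, g_mono, g_blown, g_all, hC', hycl, hover, hstalk, htr⟩

/-! ## §6. THE EXTRACTION: `IsoTailTowerExtractionMσE σ p` holds for every admissible functional σ -/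

/-- **ISOLATED-TAIL TOWER EXTRACTION FOR THE STRATEGY `σ`, AT ONE VALUE `ν`** (σ functional at `(3, ν)` and admissible on the marked
scope `Strategy.ReachableState p σ 3 ν` — the binders at THAT `ν` only): a moving σ-chain from a maximal origin of characteristic `p`, every
stage of which is an ISOLATED `ē ≥ 3` stage, yields an isolated E3 point tower over a maximal origin. σ-port of res-D-pv-042's
`isoTailTowerExtractionM_holds` (D7), same route: the STAGE TOWER of the chain from its first genuine stage (§5), whose base is a maximal
origin (§2); `H^N = ν` and `3 ≤ ē` transfer along the stalk isomorphisms; ISOLATION transfers by localising at `x_{n_j}` (res-type-053's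
`BlowupTower.isIsolatedInHSMaxLocus_localize`, upper semicontinuity over the field), crossing the link (`isIsolatedInHSMaxLocus_spec_of_iso`) and
de-localising at `y_j` (`Moving.isIsolatedInHSMaxLocus_of_spec`), the latter needing «`ν` never exceeded on `T.X j`» and «`(T.X j)_max` closed»,
which climb the tower by `IsBlowup.hsFun_le_of_isPermissible` (the point centres are permissible as `dim 𝒪 ≥ ē ≥ 3`) and CJS Lemma 2.36 over
the field. No regular-value case split is needed. [cite: CossartJannsenSaito2020, Def. 6.34, Def. 6.38, Def. 13.3, Rem. 6.29 (1), Thm. 3.10 (1), p. 107] -/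
theorem isoTailTowerExtractionσE_of_admissible {ν : ℕ → ℕ} (hfun : σ.IsFunctional 3 ν)
    (hadm : IsAdmissibleStrategyOnE (StrategyE.ReachableState p σ 3 ν E₀) 3 ν σ)
    {X : Scheme.{u}} [IsLocallyNoetherian X] {x : X} (hX : IsMaximalOrigin p 3 ν X x)
    {c : ℕ → MarkedStageE.{u}} (h0 : ReachesσE σ 3 ν (MarkedStageE.init X x (E₀ X x)) (c 0))
    (hstep : ∀ n, CanonicalNearStepσE σ 3 ν (c n) (c (n + 1))) (hGI : ∀ n, 3 ≤ (c n).toMarkedStage.geomDirDim ∧ Iso 3 (c n).toMarkedStage)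
    (hmov : ∀ n, ∃ m, n ≤ m ∧ (c m).IsBlownUpσE σ 3 ν) :
    ∃ (T : BlowupTower.{u}) (pt : ∀ n, T.X n), IsMaximalOrigin p 3 ν (T.X 0) (pt 0) ∧ IsIsoPointTower 3 ν T pt := by
  have hreach : ∀ n, ReachesσE σ 3 ν (MarkedStageE.init X x (E₀ X x)) (c n) := reachesσE_chain h0 hstep
  -- the stage tower of the chain from its first genuine stage
  obtain ⟨g, T, y, -, -, -, hC, hycl, hover, hstalk, htr⟩ :=
    exists_isoStageTower_of_movingChainσE hfun hadm hX h0 hstep hmov (fun n _ => (hGI n).2)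
  -- stage 0 of the tower is the reached stage `X_{n_0}`: a maximal origin (§2)
  have hO : IsMaximalOrigin p 3 ν (T.X 0) (y 0) :=
    htr (fun Y w => IsMaximalOrigin p 3 ν Y w) (hX.of_reachesσE hadm (hreach (g 0)))
  -- `H^N = ν` and `3 ≤ ē` at every marked point of the tower (stalk-local)
  have hH : ∀ n, Scheme.hsFun (T.X n) 3 (y n) = ν := by
    intro n
    haveI : IsLocallyNoetherian (T.X n) := T.ln n
    haveI : IsLocallyNoetherian (c (g n)).W := (c (g n)).ln
    obtain ⟨e⟩ := hstalk n
    rw [hsFun_eq_of_stalkIso e 3]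
    exact Scheme.mem_hsStratum_iff.mp (pt_mem_hsStratum_of_reachesσE (hreach (g n)) hX.mem_stratum)
  have hE : ∀ n, 3 ≤ @Scheme.geomDirDim (T.X n) (T.ln n) (y n) := by
    intro n
    haveI : IsLocallyNoetherian (T.X n) := T.ln n
    haveI : IsLocallyNoetherian (c (g n)).W := (c (g n)).ln
    obtain ⟨e⟩ := hstalk n
    have h : 3 ≤ Literature.RingTheory.HilbertSamuel.geomDirDim ((c (g n)).W.presheaf.stalk (c (g n)).pt) :=
      (hGI (g n)).1
    change 3 ≤ Literature.RingTheory.HilbertSamuel.geomDirDim ((T.X n).presheaf.stalk (y n))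
    rwa [Literature.RingTheory.HilbertSamuel.geomDirDim_eq_of_ringEquiv e.commRingCatIsoToRingEquiv] at h
  -- the structure of the stages of the tower over the field of the origin
  obtain ⟨k, _, _, f₀, hsep, hft, hqc⟩ := hO.exists_structure
  haveI := hsep
  haveI := hft
  haveI := hqc
  obtain ⟨f, -, hf1, hf2⟩ := exists_towerStructure T f₀
  have hexc : ∀ j, Scheme.IsExcellent (T.X j) := fun j =>
    haveI := hf1 j
    Scheme.isExcellent_of_locallyOfFiniteType Stacks07QW_field_holds (f j)
  have hdim : ∀ j, topologicalKrullDim (T.X j) ≤ ((3 : ℕ) : WithBot ℕ∞) := tower_dim_le T hO.dim_le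
  have hperm : ∀ j, IdealSheafData.IsPermissible (T.centreIdeal j) := by
    intro j
    haveI : IsLocallyNoetherian (T.X j) := T.ln j
    have hcl : (⟨T.C j, T.isClosed_C j⟩ : Closeds (T.X j)) = ⟨{y j}, hycl j⟩ := Closeds.ext (hC j)
    show IdealSheafData.IsPermissible (vanishingIdeal ⟨T.C j, T.isClosed_C j⟩)
    rw [hcl]
    exact isPermissible_singleton_of_three_le_geomDirDim (hycl j) (hE j)
  have hsup : ∀ j (w : T.X j), ν ≤ Scheme.hsFun (T.X j) 3 w → Scheme.hsFun (T.X j) 3 w = ν :=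
    tower_supMax T hexc hperm (fun w hw => le_antisymm (hO.maximal.2 ⟨w, rfl⟩ hw) hw)
  -- ISOLATION at every marked point of the tower: localise, cross the link, de-localise
  have hI : ∀ n, @IsIsolatedInHSMaxLocus (T.X n) (T.ln n) 3 (y n) := by
    intro n
    haveI : IsLocallyNoetherian (T.X n) := T.ln n
    let s := c (g n)
    haveI : IsLocallyNoetherian s.W := s.ln
    -- upper semicontinuity of `H` at `x_{n_j}` along generisations (the reached stage is of finite type over a field, §2)
    obtain ⟨k', _, _, f', -, hf't, -⟩ := (hX.of_reachesσE hadm (hreach (g n))).exists_structure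
    haveI := hf't
    have hsc : ∀ w : s.W, w ⤳ s.pt → Scheme.hsFun s.W 3 w ≤ Scheme.hsFun s.W 3 s.pt :=
      fun w hw => Scheme.hsFun_le_hsFun_of_specializes_over_field f' 3 hw
    -- (i) localise at `x_{n_j}` (constant tower on the stage)
    let T₀ : BlowupTower.{u} :=
      { X := fun _ => s.W, ln := fun _ => s.ln, C := fun _ => ∅, isClosed_C := fun _ => isClosed_empty,
        π := fun _ => 𝟙 s.W, isBlowup := fun _ => isBlowup_id_vanishingIdeal_empty s.W }
    have h1 : IsIsolatedInHSMaxLocus (Spec (s.W.presheaf.stalk s.pt)) 3 (closedPoint (s.W.presheaf.stalk s.pt)) :=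
      T₀.isIsolatedInHSMaxLocus_localize s.pt 3 hsc (hGI (g n)).2
    -- (ii) cross the link
    obtain ⟨e⟩ := hstalk n
    have h2 : IsIsolatedInHSMaxLocus (Spec ((T.X n).presheaf.stalk (y n))) 3 (closedPoint ((T.X n).presheaf.stalk (y n))) :=
      isIsolatedInHSMaxLocus_spec_of_iso e.symm 3 h1
    -- (iii) de-localise at `y_j`
    haveI := hf1 n
    haveI := hf2 n
    haveI : IsNoetherian (T.X n) := Scheme.isNoetherian_of_finiteType_over_field (f n)
    have hmaxy : y n ∈ Scheme.hsMaxLocus (T.X n) 3 := by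
      rw [Scheme.mem_hsMaxLocus_iff, hH n]
      exact ⟨⟨y n, hH n⟩, fun μ ⟨w, hw⟩ hle => by subst hw; exact (hsup n w hle).le⟩
    have hclmax : IsClosed (Scheme.hsMaxLocus (T.X n) 3) :=
      Scheme.isClosed_hsMaxLocus (fun μ => isClosed_hsStratumGE_over_field (f n) (hdim n) μ)
        (Scheme.finite_hsValues_of_isExcellent (hexc n) 3 (hsPsi_le_of_dim_le' (hdim n)))
    exact isIsolatedInHSMaxLocus_of_spec 3 (hycl n) hmaxy hclmax h2
  exact ⟨T, y, hO, hC, hover, hycl, hH, hI, hE⟩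

/-- **`IsoTailTowerExtractionMσE σ p` HOLDS FOR EVERY ADMISSIBLE FUNCTIONAL STRATEGY** (the row of `…Corridor3SigmaIsoDefs`; functional at
level `3` and admissible on the marked scope, at every value `ν`) — THE strategy-freeness of the isolated kernel: the Ev-Iso σ-leg of the
pointed σ-closer needs NOTHING about σ beyond admissibility. [cite: CossartJannsenSaito2020, Def. 6.34, Def. 6.38, Rem. 6.29 (1)] -/
theorem isoTailTowerExtractionMσE_of_admissible (hfun : ∀ ν, σ.IsFunctional 3 ν)
    (hadm : ∀ ν, IsAdmissibleStrategyOnE (StrategyE.ReachableState p σ 3 ν E₀) 3 ν σ) : IsoTailTowerExtractionMσE σ p E₀ :=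
  fun ν _ _ _ hX _ h0 hstep hGI hmov => isoTailTowerExtractionσE_of_admissible (hfun ν) (hadm ν) hX h0 hstep hGI hmov

/-! ## §7. COROLLARIES: the isolation rows of an admissible functional strategy from the KERNEL and the σ-laws -/

/-- **Ev-Iso σ FROM THE KERNEL ALONE** (admissible functional σ): no moving σ-chain of isolated `ē ≥ 3` stages from any `Q`-maximal origin, as
soon as isolated quadratic towers terminate. [cite: CossartJannsenSaito2020, Def. 6.38, Thm. 6.40 (pointers)] -/
theorem wtopEvIsoMσE_of_admissible (hfun : ∀ ν, σ.IsFunctional 3 ν)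
    (hadm : ∀ ν, IsAdmissibleStrategyOnE (StrategyE.ReachableState p σ 3 ν E₀) 3 ν σ) (hT : IsoQuadraticTowerTerminates.{u} p 3)
    (Q : ℕ → (ℕ → ℕ) → ∀ X : Scheme.{u}, X → Prop) : WtopEvIsoMσE σ p Q E₀ :=
  wtopEvIsoMσE_of_towers hT (isoTailTowerExtractionMσE_of_admissible hfun hadm) Q

/-- **THE POINTED σ-CLOSER FROM ADMISSIBILITY — RULINGS v3.14-11a (CP)'s signature** (with functionality added and the two D17 laws in σ-form):
for every FUNCTIONAL strategy σ ADMISSIBLE on the marked scope, `WtopRecIsoMσE σ p QPointed` follows from the strategy-free KERNEL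
`IsoQuadraticTowerTerminates p 3`, the σ-transition law and the σ-birth law at pointed origins — the v7/v8.2 pointed closers transfer to
arbitrary admissible strategies. OURS join. -/
theorem wtopRecIsoMσE_pointed_of_admissible (hfun : ∀ ν, σ.IsFunctional 3 ν)
    (hadm : ∀ ν, IsAdmissibleStrategyOnE (StrategyE.ReachableState p σ 3 ν E₀) 3 ν σ) (hT : IsoQuadraticTowerTerminates.{u} p 3)
    (hlaw : IsoTransitionLaw3σE σ p QPointed E₀) (hrec : NoRecurrentIsoPointBirth3σE σ p QPointed E₀) : WtopRecIsoMσE σ p QPointed E₀ :=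
  wtopRecIsoMσE_pointed_of_kernel (isoTailTowerExtractionMσE_of_admissible hfun hadm) hT hlaw hrec

/-- … at every origin class `Q`. OURS join. -/
theorem wtopRecIsoMσE_of_admissible (Q : ℕ → (ℕ → ℕ) → ∀ X : Scheme.{u}, X → Prop) (hfun : ∀ ν, σ.IsFunctional 3 ν)
    (hadm : ∀ ν, IsAdmissibleStrategyOnE (StrategyE.ReachableState p σ 3 ν E₀) 3 ν σ) (hT : IsoQuadraticTowerTerminates.{u} p 3)
    (hlaw : IsoTransitionLaw3σE σ p Q E₀) (hrec : NoRecurrentIsoPointBirth3σE σ p Q E₀) : WtopRecIsoMσE σ p Q E₀ :=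
  wtopRecIsoMσE_of_kernel Q (isoTailTowerExtractionMσE_of_admissible hfun hadm) hT hlaw hrec

/-- **THE FULL W-top σ-ROW AT `Q` FROM ADMISSIBILITY, THE KERNEL, THE σ-LAWS AND Ev-NonIso σ** — no moving W-top σ-chain at all from a
`Q`-maximal origin (`MaxOriginNoMovingNearChainAtQσE σ p 3 Q (3 ≤ ē)`): the shape the σ-side of `stub_Wtop_elimination` consumes origin by
origin, with 047's `WtopEvNonIsoMσE σ p Q` the remaining σ-DESIGN content. OURS join. -/
theorem atQσE_of_admissible_evNonIso (Q : ℕ → (ℕ → ℕ) → ∀ X : Scheme.{u}, X → Prop) (hfun : ∀ ν, σ.IsFunctional 3 ν)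
    (hadm : ∀ ν, IsAdmissibleStrategyOnE (StrategyE.ReachableState p σ 3 ν E₀) 3 ν σ) (hT : IsoQuadraticTowerTerminates.{u} p 3)
    (hlaw : IsoTransitionLaw3σE σ p Q E₀) (hrec : NoRecurrentIsoPointBirth3σE σ p Q E₀) (hev : WtopEvNonIsoMσE σ p Q E₀) :
    MaxOriginNoMovingNearChainAtQσE σ p 3 Q E₀ fun s => 3 ≤ s.geomDirDim :=
  atQσE_of_kernel_evNonIso Q (isoTailTowerExtractionMσE_of_admissible hfun hadm) hT hlaw hrec hev
end Summit.ResolutionOfSingularities.ResolutionOfSingularities.Theorems.SigmaMaxModificationsCorridor3.Sigma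

end
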